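import Literature.NumberTheory.Automorphic.ResGL2BorelStabilizerCharacters
import Literature.NumberTheory.Automorphic.ResGL2TensorAmbient
import Literature.NumberTheory.Automorphic.ResGL2BorelCohomologyFinite
import Literature.NumberTheory.Automorphic.ResGL2BorelEigenvalueFactorisation
import Literature.NumberTheory.Automorphic.AdmissibleTorusFactorisation
import Literature.NumberTheory.Automorphic.BorelModelOrbitRepresentatives
import Literature.NumberTheory.Automorphic.HeckeOrbitConjugation
import Literature.NumberTheory.Automorphic.TorusEigenvalueAlgebraic
import HarnessLib

/-!
# The `t^B_2`-eigenvalues on the Borel strata of `Res_{K/ℚ} GL₂` form an algebraic character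

Topic `NumberTheory/Automorphic`; namespace `Literature.NumberTheory.Automorphic.ResGLnCohomology`.
Definitions with bodies and theorems (no named fact); the `Res_{K/ℚ} GL₂` version of
`TorusEigenvalueAlgebraic` (which is `K` imaginary quadratic with neat level).

Let `K` be a number field, `𝔫 ≠ 0`, `S = {v ∣ 𝔫}`, and `y₀ ≠ 0` a class in the Borel model of the
stratum `H^q(B(K)⁺, Fun(GL₂(𝔸_K^∞)/K_f(𝔫), E_λ))` which is an eigenvector of the good-place torus
operators `T^B_{e₂,w}` with eigenvalues `μ_w` (`w ∉ S`).  Then (`exists_torus_exponents_borelPos`)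
**there are integers `e_τ` (`τ : K →+* E`) with**

  `∏_{w ∣ (x)} μ_w^{ord_w x} = ∏_τ τ(x)^{e_τ}`

**for every totally positive `x ∈ 𝓞_K ∖ 0` with `x ≡ 1 mod 𝔫`.**

Proof [Harder1987, §2, (2.3)–(2.8)]: (μ1) a supported boundary point on whose orbit `y₀` restricts
to `z ≠ 0` (`BorelModelOrbitRepresentatives`, `exists_finite_cover_borelPosOrbits`); (μ2)
`T_{ι(diag(1,x))} y₀ = M(x) y₀`, `M(x) = ∏_w μ_w^{ord_w x}` (`AdmissibleTorusFactorisation`); (μ3) on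
`H^q(Γ_x, E_λ)` the operator `T_{ι(diag(1,x))}` is the pair map of conjugation by `diag(1, x)`
(`HeckeOrbitConjugation`, `AdmissibleTorusOrbit`); (μ4) these pair maps are scalar-filtered with
algebraic characters (`mem_algCharSet_of_eigen`: the character dévissage
`PairMapFiltrationCharacters` of `E_λ ⊆ 𝕋` (`ResGL2TensorAmbient`) over the character pieces
`ResGL2BorelStabilizerCharacters`), so the eigencharacter `M` of `z` is algebraic.

## References

* G. Harder, *Eisenstein cohomology of arithmetic groups. The case GL₂*, Invent. Math. 89 (1987), §2.
  [Harder1987]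
-/

noncomputable section

open scoped NumberField
open NumberField IsDedekindDomain CategoryTheory groupCohomology Literature.LinearAlgebra Literature.Algebra.Homology
  Literature.NumberTheory.Automorphic.BigHeckeGLn Literature.NumberTheory.Automorphic.ParallelWeight
  Literature.NumberTheory.Automorphic.BorelLattice Literature.NumberTheory.Automorphic.ResWeight

namespace Literature.NumberTheory.Automorphic

namespace ResGLnCohomology

variable {K : Type} [Field K] [NumberField K]

/-! ### The characters `χ_I` of `B(K)⁺` -/

section Characters

variable {E : Type} [Field E] [CharZero E] (d : (K →+* E) → ℕ) (m : (K →+* E) → ℤ)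

omit [NumberField K] in
/-- Elements of `B(K)⁺` are upper triangular. [folklore] -/
theorem borelPosToGL_apply_one_zero (γ : borelPos K) :
    ((borelPosToGL K γ : GL (Fin 2) K) : Matrix (Fin 2) (Fin 2) K) 1 0 = 0 :=
  (mem_borelPos_iff (γ : glTotPos 2 K)).1 γ.2

/-- `χ_I(γ) ≠ 0` for `γ ∈ B(K)⁺`. [folklore] -/
theorem ambientChar_borelPosToGL_ne_zero (I : AmbIdx E K d) (γ : borelPos K) :
    ambientChar E K d m I (borelPosToGL K γ) ≠ 0 := by
  classical
  obtain ⟨a, δ, β, h⟩ := exists_eq_bMat (borelPosToGL_apply_one_zero γ)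
  rw [h]
  unfold ResWeight.ambientChar
  refine mul_ne_zero (Finset.prod_ne_zero_iff.2 fun τ _ => Units.ne_zero _)
    (Finset.prod_ne_zero_iff.2 fun τ _ => Finset.prod_ne_zero_iff.2 fun i _ => ?_)
  rw [map_ne_zero]
  have : ∀ j : Fin 2, ((bMat a β δ : GL (Fin 2) K) : Matrix (Fin 2) (Fin 2) K) j j ≠ 0 := by
    intro j
    fin_cases j
    · simp
    · simp
  exact this _

/-- **The character `χ_I : B(K)⁺ →* Eˣ`.** [cite: Harder1987, §2, (2.6)] -/
def ambientCharHom (I : AmbIdx E K d) : borelPos K →* Eˣ where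
  toFun γ := Units.mk0 (ambientChar E K d m I (borelPosToGL K γ)) (ambientChar_borelPosToGL_ne_zero d m I γ)
  map_one' := Units.ext (by
    rw [Units.val_mk0, Units.val_one, map_one]
    classical
    exact ambientChar_one E K d m I)
  map_mul' γ γ' := Units.ext (by
    rw [Units.val_mk0, Units.val_mul, Units.val_mk0, Units.val_mk0, map_mul]
    classical
    exact ambientChar_mul_of_borel E K d m I _ _ (borelPosToGL_apply_one_zero γ) (borelPosToGL_apply_one_zero γ'))

/-- Unfolding `ambientCharHom`. [folklore] -/
@[simp]
theorem coe_ambientCharHom_apply (I : AmbIdx E K d) (γ : borelPos K) :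
    ((ambientCharHom d m I γ : Eˣ) : E) = ambientChar E K d m I (borelPosToGL K γ) := rfl

omit [NumberField K] [CharZero E] in
/-- `det (τ (a β; 0 δ)) = τ(a δ)` as units of `E`. [folklore] -/
theorem det_map_bMat (τ : K →+* E) (a : Kˣ) (β : K) (δ : Kˣ) :
    Matrix.GeneralLinearGroup.det (Matrix.GeneralLinearGroup.map τ (bMat a β δ)) =
      Units.map (τ : K →* E) (a * δ) := by
  refine Units.ext ?_
  rw [Matrix.GeneralLinearGroup.val_det_apply, Units.coe_map]
  change Matrix.det (((bMat a β δ : GL (Fin 2) K) : Matrix (Fin 2) (Fin 2) K).map τ) = τ ((a * δ : Kˣ) : K)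
  rw [← RingHom.mapMatrix_apply, ← RingHom.map_det, coe_bMat, Matrix.det_fin_two_of, Units.val_mul]
  simp

/-- `χ_I` is trivial on the unipotent elements `n(β)`. [folklore] -/
theorem ambientCharHom_unipPos (I : AmbIdx E K d) (β : K) : ambientCharHom d m I (unipPos K β) = 1 := by
  classical
  refine Units.ext ?_
  rw [coe_ambientCharHom_apply, borelPosToGL_unipPos, Units.val_one]
  unfold ResWeight.ambientChar
  have hdet : ∀ τ : K →+* E, Matrix.GeneralLinearGroup.det (Matrix.GeneralLinearGroup.map τ (bMat (1 : Kˣ) β 1)) = 1 := by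
    intro τ
    rw [det_map_bMat, mul_one, map_one]
  have hdiag : ∀ (τ : K →+* E) (j : Fin 2), τ (((bMat (1 : Kˣ) β 1 : GL (Fin 2) K) : Matrix (Fin 2) (Fin 2) K) j j) = 1 := by
    intro τ j
    fin_cases j <;> simp
  simp_rw [hdet, one_zpow, Units.val_one, Finset.prod_const_one, one_mul, hdiag, Finset.prod_const_one]

/-- **The characters at the torus elements**: `χ_I(diag(1, x)) = ∏_τ τ(x)^{m_τ + #{i : I τ i = 1}}`.
[cite: Harder1987, §2, (2.7)] -/
theorem ambientChar_bMat_one_zero (I : AmbIdx E K d) (x : Kˣ) :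
    ambientChar E K d m I (bMat 1 0 x) =
      ∏ τ : K →+* E, τ (x : K) ^ (m τ + ((Finset.univ.filter fun i : Fin (d τ) => I τ i = 1).card : ℤ)) := by
  classical
  have hτx : ∀ τ : K →+* E, τ (x : K) ≠ 0 := fun τ => (map_ne_zero τ).2 x.ne_zero
  unfold ResWeight.ambientChar
  rw [← Finset.prod_mul_distrib]
  refine Finset.prod_congr rfl fun τ _ => ?_
  rw [zpow_add₀ (hτx τ), zpow_natCast]
  congr 1
  · rw [Units.val_zpow_eq_zpow_val, det_map_bMat, one_mul, Units.coe_map]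
    rfl
  · rw [← Finset.prod_const, ← Finset.prod_filter_mul_prod_filter_not Finset.univ (fun i : Fin (d τ) => I τ i = 1)]
    rw [show (∏ i ∈ Finset.univ.filter (fun i : Fin (d τ) => ¬ I τ i = 1),
        τ (((bMat (1 : Kˣ) (0 : K) x : GL (Fin 2) K) : Matrix (Fin 2) (Fin 2) K) (I τ i) (I τ i))) = 1 from ?_, mul_one]
    · refine Finset.prod_congr rfl fun i hi => ?_
      rw [(Finset.mem_filter.1 hi).2, bMat_apply_one_one]
    · refine Finset.prod_eq_one fun i hi => ?_
      have h1 : I τ i = 0 := by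
        have := (Finset.mem_filter.1 hi).2
        omega
      rw [h1, bMat_apply_zero_zero, Units.val_one, map_one]

/-- `χ_I(s)` for `s ↦ diag(1, x)` is an algebraic character of `x`. [folklore] -/
theorem ambientCharHom_mem_algCharSet (I : AmbIdx E K d) {X : Type} (s : X → borelPos K) (xu : X → Kˣ)
    (hs : ∀ x, borelPosToGL K (s x) = bMat 1 0 (xu x)) :
    (fun x => ((ambientCharHom d m I (s x) : Eˣ) : E)) ∈ algCharSet (E := E) (fun x => ((xu x : Kˣ) : K)) := by
  classical
  refine ⟨fun τ => m τ + ((Finset.univ.filter fun i : Fin (d τ) => I τ i = 1).card : ℤ), fun x => ?_⟩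
  change ((ambientCharHom d m I (s x) : Eˣ) : E) = ∏ τ : K →+* E, τ ((xu x : Kˣ) : K) ^ (m τ + _)
  rw [coe_ambientCharHom_apply, hs, ambientChar_bMat_one_zero]

end Characters

/-! ### (μ4) The eigencharacter of a common eigenvector on `H^q(Γ_x, E_λ)` is algebraic -/

section Mu4

variable {E : Type} [Field E] [CharZero E] [IsAlgClosed E] (lam : (K →+* E) → Fin 2 → ℤ)

variable (K E) in
/-- `E_λ` as a representation of `B(K)⁺`. [folklore] -/
abbrev coeffRepBorelPos : Rep E (borelPos K) :=
  Rep.of (((coeffRepPos E 2 K lam).comp (borelPos K).subtype :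
    Representation E (borelPos K) (ResGLnCohomology.CoeffModule E 2 K lam)))

variable (K E) in
/-- The ambient tensor representation restricted to `B(K)⁺`. [folklore] -/
abbrev borelPosAmbientRep : Representation E (borelPos K) (TensorAmbient E K (deg E K lam)) :=
  (ambientRep E K (deg E K lam) (twist E K lam)).comp (borelPosToGL K)

variable (K E) in
/-- The ambient `𝕋` as a representation of `B(K)⁺` in Mathlib's `Rep`. [folklore] -/
abbrev ambientRepBorelPos : Rep E (borelPos K) :=
  Rep.of (X := ModuleCat.of E (TensorAmbient E K (deg E K lam))) (borelPosAmbientRep K E lam)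

/-- The embedding `E_λ ↪ 𝕋` as a morphism of representations of a subgroup `Γ ≤ B(K)⁺`. [folklore] -/
def coeffToAmbientHom (Γ : Subgroup (borelPos K)) : resSub Γ (coeffRepBorelPos K E lam) ⟶ resSub Γ (ambientRepBorelPos K E lam) :=
  Rep.ofHom (LinearMap.intertwiningMap_of_isIntertwiningMap _ _ (coeffToAmbient E K lam) fun _ v =>
    coeffToAmbient_coeffRep E K lam _ v)

omit [NumberField K] [CharZero E] [IsAlgClosed E] in
/-- Unfolding `coeffToAmbientHom`. [folklore] -/
theorem coeffToAmbientHom_hom_apply (Γ : Subgroup (borelPos K)) (v : ResGLnCohomology.CoeffModule E 2 K lam) :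
    (coeffToAmbientHom lam Γ).hom v = coeffToAmbient E K lam v := rfl

/-- **(μ4) The eigencharacter of a common eigenvector of the torus pair maps on `H^q(Γ_x, E_λ)` is
algebraic.**  For `Γ_x = borelPosStabilizer 𝔫 t c` (`c` integral), integral totally positive torus
elements `s_x ↦ diag(1, x)` normalising `Γ_x`, and `z ≠ 0` in `H^q(Γ_x, E_λ)` with
`Φ_x z = M(x) z` for the pair maps `Φ_x = H^q(γ ↦ s_x⁻¹ γ s_x, E_λ(s_x))`, the character `M` is
`x ↦ ∏_τ τ(x)^{e_τ}`. [cite: Harder1987, §2, (2.6)–(2.8)] -/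
theorem mem_algCharSet_of_eigen {𝔫 : Ideal (𝓞 K)} (h𝔫 : 𝔫 ≠ 0) (t : Fin 2 → (FiniteAdeleRing (𝓞 K) K)ˣ)
    {c₀ : FiniteAdelicGL 2 K} (hc₀ : c₀ ∈ glFiniteIntegralLevel 2 K) {Γ : Subgroup (borelPos K)}
    (hΓ : Γ = borelPosStabilizer 𝔫 t c₀) {X : Type} (s : X → borelPos K) (xu : X → Kˣ)
    (hxint : ∀ x (v : HeightOneSpectrum (𝓞 K)), v.valuation K ((xu x : Kˣ) : K) ≤ 1)
    (hs : ∀ x, borelPosToGL K (s x) = bMat 1 0 (xu x)) (hsΓ : ∀ x, ∀ γ ∈ Γ, (s x)⁻¹ * γ * s x ∈ Γ) (q : ℕ)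
    {z : groupCohomology (resSub Γ (coeffRepBorelPos K E lam)) q} (hz : z ≠ 0) (M : X → E)
    (heig : ∀ x, (groupCohomology.map (subgroupConj Γ (s x) (hsΓ x))
      (resConj Γ (coeffRepBorelPos K E lam) (s x) (hsΓ x)) q).hom z = M x • z) :
    M ∈ algCharSet (E := E) (fun x => ((xu x : Kˣ) : K)) := by
  subst hΓ
  classical
  have hcard : Fintype.card (K →+* E) = Module.finrank ℚ K := Embeddings.card K E
  -- the pair maps on the ambient and on `E_λ`
  let cx := fun x => subgroupConj (borelPosStabilizer 𝔫 t c₀) (s x) (hsΓ x)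
  let φ := fun x => resConj (borelPosStabilizer 𝔫 t c₀) (ambientRepBorelPos K E lam) (s x) (hsΓ x)
  let ψ := fun x => resConj (borelPosStabilizer 𝔫 t c₀) (coeffRepBorelPos K E lam) (s x) (hsΓ x)
  let η := fun I : AmbIdx E K (deg E K lam) =>
    (ambientCharHom (deg E K lam) (twist E K lam) I).comp (borelPosStabilizer 𝔫 t c₀).subtype
  let χ := fun (I : AmbIdx E K (deg E K lam)) (x : X) => ((ambientCharHom (deg E K lam) (twist E K lam) I (s x) : Eˣ) : E)
  have hηc : ∀ I x g, η I (cx x g) = η I g := fun I x g =>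
    char_conj_eq (ambientCharHom (deg E K lam) (twist E K lam) I) (s x) g
  have hwG : ∀ (g : borelPosStabilizer 𝔫 t c₀) (I : AmbIdx E K (deg E K lam)),
      (resSub (borelPosStabilizer 𝔫 t c₀) (ambientRepBorelPos K E lam)).ρ g (ambientBasis E K (deg E K lam) I) -
        ((η I g : Eˣ) : E) • ambientBasis E K (deg E K lam) I ∈
      lowerSpan (ambientBasis E K (deg E K lam)) (ambRank E K (deg E K lam)) (ambRank E K (deg E K lam) I) :=
    fun g I => ambientRep_basis_sub_smul_mem_span_of_borel E K _ _ _ (borelPosToGL_apply_one_zero _) I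
  have hwφ : ∀ x (I : AmbIdx E K (deg E K lam)), (φ x).hom (ambientBasis E K (deg E K lam) I) - χ I x • ambientBasis E K (deg E K lam) I ∈
      lowerSpan (ambientBasis E K (deg E K lam)) (ambRank E K (deg E K lam)) (ambRank E K (deg E K lam) I) := by
    intro x I
    have h : (φ x).hom (ambientBasis E K (deg E K lam) I) = χ I x • ambientBasis E K (deg E K lam) I := by
      rw [resConj_hom_apply]
      change ambientRep E K (deg E K lam) (twist E K lam) (borelPosToGL K (s x)) (ambientBasis E K (deg E K lam) I) = _
      rw [ambientRep_basis_of_isDiag E K _ _ _ ?_ (borelPosToGL_apply_one_zero _) I]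
      · rfl
      · rw [hs, bMat_apply_zero_one]
    rw [h, sub_self]
    exact Submodule.zero_mem _
  have hrank : Function.Injective (ambRank E K (deg E K lam)) := fun I J h => ambRank_eq_imp_eq E K _ I J h
  have htriv : ∀ I n, ScalarFiltered (fun x => pairMapChar (η I) (cx x) (hηc I x) (χ I x) n)
      (algCharSet (E := E) (fun x => ((xu x : Kˣ) : K))) ⊤ := fun I n =>
    scalarFiltered_pairMapChar_borelPosStabilizer h𝔫 t hc₀ hcard s xu hxint hs hsΓ
      (ambientCharHom (deg E K lam) (twist E K lam) I) (ambientCharHom_unipPos _ _ I)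
      (ambientCharHom_mem_algCharSet _ _ I s xu hs) (fun x γ => hηc I x γ) n
  have hj : Function.Injective (coeffToAmbientHom lam (borelPosStabilizer 𝔫 t c₀)).hom := coeffToAmbient_injective E K lam
  have hjψ : ∀ x b, (coeffToAmbientHom lam (borelPosStabilizer 𝔫 t c₀)).hom ((ψ x).hom b) =
      (φ x).hom ((coeffToAmbientHom lam (borelPosStabilizer 𝔫 t c₀)).hom b) := fun x b => by
    rw [coeffToAmbientHom_hom_apply, coeffToAmbientHom_hom_apply, resConj_hom_apply, resConj_hom_apply]
    exact coeffToAmbient_coeffRep E K lam _ b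
  have hjle : LinearMap.range (coeffToAmbientHom lam (borelPosStabilizer 𝔫 t c₀)).hom.toLinearMap ≤
      Submodule.span E (Set.range (ambientBasis E K (deg E K lam))) := by
    rw [(ambientBasis E K (deg E K lam)).span_eq]
    exact le_top
  have hSF := scalarFiltered_of_injective_hom_char cx φ (algCharSet (E := E) (fun x => ((xu x : Kˣ) : K)))
    (ambientBasis E K (deg E K lam)) (ambRank E K (deg E K lam)) η hwG χ hwφ hrank hηc htriv ψ
    (coeffToAmbientHom lam (borelPosStabilizer 𝔫 t c₀)) hj hjψ hjle q
  obtain ⟨ω, hω, hMω⟩ := hSF.exists_eq_of_eigenvector_top hz M heig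
  rwa [show M = ω from funext hMω]

end Mu4

/-! ### (μ1)–(μ3) and the main theorem -/

section Main

variable {E : Type} [Field E] [CharZero E] [IsAlgClosed E] (lam : (K →+* E) → Fin 2 → ℤ)

omit [NumberField K] in
/-- `diag(1, x) = (1 0; 0 x)`. [folklore] -/
theorem bMat_one_zero_eq_diagOneX (x : K) (hx : x ≠ 0) : bMat 1 0 (Units.mk0 x hx) = diagOneX x hx := by
  refine Units.ext (Matrix.ext fun i j => ?_)
  rw [coe_bMat, coe_diagOneX]
  fin_cases i <;> fin_cases j <;> simp

/-- The totally positive torus element `s_x = diag(1, x) ∈ B(K)⁺`. [folklore] -/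
def torusPos (x : K) (hx : x ≠ 0) (hpos : ∀ τ : K →+* ℝ, 0 < τ x) : borelPos K :=
  bMatPos 1 (Units.mk0 x hx) 0 (fun τ => by simpa using hpos τ)

omit [NumberField K] in
/-- `s_x` in `GL₂(K)`. [folklore] -/
theorem borelPosToGL_torusPos (x : K) (hx : x ≠ 0) (hpos : ∀ τ : K →+* ℝ, 0 < τ x) :
    borelPosToGL K (torusPos x hx hpos) = bMat 1 0 (Units.mk0 x hx) :=
  borelPosToGL_bMatPos _ _ _ _

/-- `ι_S(s_x) = ι(diag(1, x)) ∈ H_S`. [folklore] -/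
theorem codRestrict_torusPos (S : Set (HeightOneSpectrum (𝓞 K))) (x : K) (hx : x ≠ 0) (hpos : ∀ τ : K →+* ℝ, 0 < τ x) :
    ((diagPos 2 K).comp (borelPos K).subtype).codRestrict (borelAwayFrom S) (diagPos_borelPos_mem_borelAwayFrom _)
      (torusPos x hx hpos) = admissibleDiagH S x hx := by
  refine Subtype.ext ?_
  change globalEmbedding 2 K (borelPosToGL K (torusPos x hx hpos)) = admissibleDiag x hx
  rw [borelPosToGL_torusPos, bMat_one_zero_eq_diagOneX]
  rfl

/-- `x ≡ 1 mod 𝔫` is prime to the primes of `𝔫`. [folklore] -/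
theorem not_dvd_span_of_sub_one_mem {𝔫 : Ideal (𝓞 K)} {x : 𝓞 K} (hx1 : x - 1 ∈ 𝔫) (w : HeightOneSpectrum (𝓞 K))
    (hw : w.asIdeal ∣ 𝔫) : ¬ w.asIdeal ∣ Ideal.span {x} := by
  intro h
  rw [Ideal.dvd_span_singleton] at h
  have h1 : (1 : 𝓞 K) ∈ w.asIdeal := by
    have := w.asIdeal.sub_mem h (Ideal.le_of_dvd hw hx1)
    rwa [sub_sub_cancel] at this
  exact w.isPrime.ne_top ((Ideal.eq_top_iff_one _).2 h1)

/-- **The `t^B_2`-eigenvalues on the Borel strata of `Res_{K/ℚ} GL₂` form an algebraic character on the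
totally positive admissible elements.**  See the module docstring. [cite: Harder1987, §2, (2.3)–(2.8)] -/
theorem exists_torus_exponents_borelPos {𝔫 : Ideal (𝓞 K)} (h𝔫 : 𝔫 ≠ 0) (q : ℕ)
    {y₀ : borelPosModelCohomology E K 𝔫 lam q} (hy₀ : y₀ ≠ 0) (μ : HeightOneSpectrum (𝓞 K) → E)
    (hμ : ∀ w : HeightOneSpectrum (𝓞 K), ¬ w.asIdeal ∣ 𝔫 →
      borelPosModelHecke E K 𝔫 lam q (borelHeckeElement₂ _ w) y₀ = μ w • y₀) :
    ∃ e : (K →+* E) → ℤ, ∀ (x : 𝓞 K) (hx : x ≠ 0), x - 1 ∈ 𝔫 → (∀ τ : K →+* ℝ, 0 < τ (x : K)) →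
      ((suppOf x hx).toList.map fun w => μ w ^ ordAt w x).prod = ∏ τ : K →+* E, τ (x : K) ^ e τ := by
  classical
  let S : Set (HeightOneSpectrum (𝓞 K)) := {v | v.asIdeal ∣ 𝔫}
  have hS : ∀ v : HeightOneSpectrum (𝓞 K), v.asIdeal ∣ 𝔫 → v ∈ S := fun _ hv => hv
  let ι₀ := (diagPos 2 K).comp (borelPos K).subtype
  have hι₀ : ∀ γ, ι₀ γ ∈ borelAwayFrom (n := 2) S := diagPos_borelPos_mem_borelAwayFrom _
  let ιB := ι₀.codRestrict (borelAwayFrom (n := 2) S) hι₀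
  let L : Subgroup (FiniteAdelicGL 2 K) := level 2 K 𝔫
  let LH : Subgroup (borelAwayFrom (n := 2) S) := L.subgroupOf (borelAwayFrom S)
  let ρ := (coeffRepPos E 2 K lam).comp (borelPos K).subtype
  -- (μ1) a supported boundary point on whose orbit `y₀` is non-zero
  obtain ⟨s₁, hs₁, hcov⟩ := exists_finite_cover_borelPosOrbits (K := K) h𝔫
  obtain ⟨x₀, hx₀, hne⟩ := TwistedQuotient.exists_toOrbitCohomology_ne_zero_subgroupModel ι₀ L ρ
    (borelAwayFrom (n := 2) S) hι₀ (forall_exists_borelAwayFrom_mul_level h𝔫) s₁ hcov q hy₀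
  obtain ⟨t, c, hc, hxe⟩ := hs₁ _ hx₀
  set c' := supportedPart S c hc with hc'
  have hc'S : ∀ v : HeightOneSpectrum (𝓞 K), ¬ v.asIdeal ∣ 𝔫 → localComponent 2 K v c' = 1 :=
    fun v hv => localComponent_supportedPart_of_not_mem hc hv
  have hc'int : c' ∈ glFiniteIntegralLevel 2 K := supportedPart_mem_glFiniteIntegralLevel _ hc
  have hmem : glDiagonal 2 (FiniteAdeleRing (𝓞 K) K) t * c' ∈ borelAwayFrom (n := 2) S :=
    glDiagonal_mul_mem_borelAwayFrom t fun v hv => hc'S v fun h => hv (hS v h)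
  let xH : borelAwayFrom (n := 2) S := ⟨_, hmem⟩
  have hxHcoe : (xH : FiniteAdelicGL 2 K) = glDiagonal 2 (FiniteAdeleRing (𝓞 K) K) t * c' := rfl
  have hx' : x₀ = (xH : borelAwayFrom (n := 2) S ⧸ LH) := by
    refine TwistedQuotient.toQuot_injective L (borelAwayFrom (n := 2) S) ?_
    rw [hxe, TwistedQuotient.toQuot_mk]
    exact coe_glDiagonal_mul_eq_coe_glDiagonal_mul_supportedPart h𝔫 (fun v hv => hv) t hc
  set z := TwistedQuotient.toOrbitCohomology ιB LH ρ (xH : borelAwayFrom (n := 2) S ⧸ LH) q y₀ with hzdef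
  have hz : z ≠ 0 := by rw [hzdef, ← hx']; exact hne
  -- the totally positive admissible elements and their torus elements
  let X : Type := {x : 𝓞 K // x ≠ 0 ∧ x - 1 ∈ 𝔫 ∧ ∀ τ : K →+* ℝ, 0 < τ (x : K)}
  have hX0 : ∀ x : X, ((x.1 : 𝓞 K) : K) ≠ 0 := fun x => by exact_mod_cast x.2.1
  have hxS : ∀ x : X, ∀ w ∈ S, ¬ w.asIdeal ∣ Ideal.span {(x.1 : 𝓞 K)} := fun x w hw =>
    not_dvd_span_of_sub_one_mem x.2.2.1 w hw
  let s : X → borelPos K := fun x => torusPos ((x.1 : 𝓞 K) : K) (hX0 x) x.2.2.2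
  let xu : X → Kˣ := fun x => Units.mk0 ((x.1 : 𝓞 K) : K) (hX0 x)
  have hs : ∀ x, borelPosToGL K (s x) = bMat 1 0 (xu x) := fun x => borelPosToGL_torusPos _ _ _
  have hsg : ∀ x : X, ιB (s x) = admissibleDiagH S ((x.1 : 𝓞 K) : K) (hX0 x) := fun x =>
    codRestrict_torusPos S _ _ _
  have hxint : ∀ (x : X) (v : HeightOneSpectrum (𝓞 K)), v.valuation K ((xu x : Kˣ) : K) ≤ 1 := fun x v =>
    v.valuation_le_one (x.1 : 𝓞 K)
  have hUnr : ∀ w, w ∉ S → ArithmeticQuotient.IsUnramifiedLevel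
      (valuedCongruenceSubgroup (Fin 2) (1 : WithZero (Multiplicative ℤ))) (ofLocal 2 K w) (localComponent 2 K w) L :=
    fun w hw => isUnramifiedLevel_comap_principalCongruenceLevel h𝔫 fun h => hw (hS w h)
  -- (μ2) `T_{ι(s_x)} y₀ = M(x) y₀`
  have hT : ∀ x : X, TwistedQuotient.heckeEnd ιB LH ρ (ιB (s x)) q y₀ =
      ((suppOf x.1 x.2.1).toList.map fun w => μ w ^ ordAt w x.1).prod • y₀ := by
    intro x
    have hsupp : ∀ w ∈ suppOf x.1 x.2.1, w ∉ S := fun w hw hwS => hxS x w hwS ((mem_suppOf x.2.1).1 hw)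
    have h := borelModelHecke_admissibleDiagH S L ι₀ hι₀ ρ q h𝔫 le_rfl hS hUnr x.2.1 x.2.2.1 (hxS x)
    rw [hsg x]
    change borelModelHecke S L ι₀ hι₀ ρ q (admissibleDiagH S ((x.1 : 𝓞 K) : K) _) y₀ = _
    rw [h]
    exact list_prod_apply_eq_prod_smul (fun w => borelModelHecke S L ι₀ hι₀ ρ q (borelHeckeElement₂ S w) ^ ordAt w x.1)
      (fun w => μ w ^ ordAt w x.1) y₀ _ fun w hw =>
        pow_apply_eq_pow_smul _ _ _ (hμ w (hsupp w (Finset.mem_toList.1 hw))) _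
  -- the hypotheses of `HeckeOrbitConjugation`
  have hg : ∀ x : X, ∀ l ∈ LH, (ιB (s x))⁻¹ * l * ιB (s x) ∈ LH := by
    intro x l hl
    have hdec : ιB (s x) = torusWord S x.1 x.2.1 * ((torusWord S x.1 x.2.1)⁻¹ *
        admissibleDiagH S ((x.1 : 𝓞 K) : K) (hX0 x)) := by
      rw [mul_inv_cancel_left, hsg]
    have hu := torusWord_inv_mul_admissibleDiagH_mem S h𝔫 (le_refl L) x.2.1 x.2.2.1 (fun w hw => hxS x w (hS w hw))
    have hsupp : ∀ w ∈ suppOf x.1 x.2.1, w ∉ S := fun w hw hwS => hxS x w hwS ((mem_suppOf x.2.1).1 hw)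
    have hW : ∀ m ∈ LH, (torusWord S x.1 x.2.1)⁻¹ * m * torusWord S x.1 x.2.1 ∈ LH := by
      refine TwistedQuotient.conj_mem_of_list_prod _ fun g hg' => ?_
      obtain ⟨w, hw, rfl⟩ := List.mem_map.1 hg'
      have hwS : w ∉ S := hsupp w (Finset.mem_toList.1 hw)
      exact TwistedQuotient.conj_mem_of_pow (borelHeckeElement₂_conj_mem hwS (hUnr w hwS)) _
    rw [hdec, mul_inv_rev, show ((torusWord S x.1 x.2.1)⁻¹ * admissibleDiagH S ((x.1 : 𝓞 K) : K) (hX0 x))⁻¹ *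
        (torusWord S x.1 x.2.1)⁻¹ * l * (torusWord S x.1 x.2.1 * ((torusWord S x.1 x.2.1)⁻¹ *
          admissibleDiagH S ((x.1 : 𝓞 K) : K) (hX0 x))) =
        ((torusWord S x.1 x.2.1)⁻¹ * admissibleDiagH S ((x.1 : 𝓞 K) : K) (hX0 x))⁻¹ *
          ((torusWord S x.1 x.2.1)⁻¹ * l * torusWord S x.1 x.2.1) *
          ((torusWord S x.1 x.2.1)⁻¹ * admissibleDiagH S ((x.1 : 𝓞 K) : K) (hX0 x)) by group]
    exact mul_mem (mul_mem (inv_mem hu) (hW l hl)) hu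
  have hxq : ∀ x : X, ((xH * ιB (s x) : borelAwayFrom (n := 2) S) : borelAwayFrom (n := 2) S ⧸ LH) =
      ιB (s x) • ((xH : borelAwayFrom (n := 2) S) : borelAwayFrom (n := 2) S ⧸ LH) := by
    intro x
    rw [MulAction.Quotient.smul_coe, smul_eq_mul, eq_comm, QuotientGroup.eq, Subgroup.mem_subgroupOf,
      Subgroup.coe_mul, Subgroup.coe_inv, Subgroup.coe_mul, Subgroup.coe_mul, hxHcoe]
    have hgcoe : ((ιB (s x) : borelAwayFrom (n := 2) S) : FiniteAdelicGL 2 K) =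
        admissibleDiag ((x.1 : 𝓞 K) : K) (hX0 x) := by rw [hsg]; rfl
    rw [hgcoe]
    have h := orbitCondition_admissibleDiag (K := K) h𝔫 (S := S) (fun _ hv => hv) t hc'int
      (fun v hv => hc'S v hv) x.1 (hX0 x) x.2.2.1
    simp only [mul_inv_rev, mul_assoc] at h ⊢
    exact h
  -- (μ3) the torus operators on `H^q(Γ_x, E_λ)` have the eigenvalues `M(x)` on `z ≠ 0`
  set Λ := TwistedQuotient.orbitStabilizer ιB LH ((xH : borelAwayFrom (n := 2) S) : borelAwayFrom (n := 2) S ⧸ LH)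
    with hΛdef
  have hΛ : Λ = borelPosStabilizer 𝔫 t c' :=
    TwistedQuotient.orbitStabilizer_codRestrict_eq ι₀ L (borelAwayFrom (n := 2) S) hι₀ xH
  have hsΛ : ∀ x : X, ∀ γ ∈ Λ, (s x)⁻¹ * γ * s x ∈ Λ := fun x γ hγ =>
    TwistedQuotient.conj_mem_orbitStabilizer ιB LH (hg x) xH (hxq x) γ hγ
  have heig : ∀ x : X, (groupCohomology.map (subgroupConj Λ (s x) (hsΛ x))
      (resConj Λ (coeffRepBorelPos K E lam) (s x) (hsΛ x)) q).hom z =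
        ((suppOf x.1 x.2.1).toList.map fun w => μ w ^ ordAt w x.1).prod • z := by
    intro x
    have h := TwistedQuotient.toOrbitCohomology_heckeEnd ιB LH ρ (hg x) xH (hxq x) q y₀
    rw [hT x, map_smul] at h
    exact h.symm
  -- (μ4)
  obtain ⟨p, hp⟩ := mem_algCharSet_of_eigen lam h𝔫 t hc'int hΛ s xu hxint hs hsΛ q hz _ heig
  refine ⟨p, fun x hx0 hx1 hxpos => ?_⟩
  exact hp ⟨x, hx0, hx1, hxpos⟩

end Main

end ResGLnCohomology

end Literature.NumberTheory.Automorphic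

end
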